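import Literature.AnabelianGeometry.AbsoluteAnabelian.AbsTopI.SemiAbsoluteChains
import HarnessLib

/-!
# [AbsTopI] Theorem 4.7 (ii) (morphism part) and (iv): PROOFS

Proof-only companion to `AbsTopI/SemiAbsoluteChains.lean` (S. Mochizuki, *Topics in Absolute
Anabelian Geometry I*, Thm 4.7 pp. 56–58, lit key `paper:url-11ac98ba15fc`).  The printed proof of
Thm 4.7 (ii)/(iv) is "it suffices to observe that the definitions of the various categories involved
are entirely group-theoretic" (p. 58); here the part of that transport of structure which concerns
MORPHISMS is carried out over abc-iut-L4-t4's Π-chains (`AbsTopIChains.lean`): chain isomorphisms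
over `φ : E ≅ F` (`AbsTopI.PiChainIsoOver`) invert and compose, and terminal homomorphisms / terminal
isomorphisms / isomorphy classes correspond under them.  Consequences: `thm_4_7_iv_holds :
AbsTopI.Thm_4_7_iv` (the named fact of Thm 4.7 (iv) is DISCHARGED) and `thm_4_7_ii_morphisms` (the
third conjunct of `AbsTopI.Thm_4_7_ii`).  The OBJECT part of (ii) (every `Π_E`-chain is
`φ`-isomorphic to a `Π_F`-chain) is not proved here.  No new definitions.
[cite: MochizukiAbsTopI2012, Thm 4.7 (iv) p.57]
-/

noncomputable section

open CategoryTheory Topology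
open scoped Pointwise

universe u

namespace Literature.AnabelianGeometry.AbsoluteAnabelian.AbsTopI

open Literature.AlgebraicGeometry.Frobenioids (IsSlimGroup)
open FundamentalExtension

variable {E F : FundamentalExtension.{u}}

/-! ### Π-chain isomorphisms: inverse, composition; transfer of terminal (iso)morphisms -/

namespace PiChainIsoOver

variable {K : FundamentalExtension.{u}} {φ : E ≅ F} {ψ : F ≅ K}
  {C₁ : CuspidalData E} {hP₁ : IsSlimGroup E.arith} {hΔ₁ : IsSlimGroup E.geom} {hne₁ : E.geom ≠ ⊥}
  {C₂ : CuspidalData F} {hP₂ : IsSlimGroup F.arith} {hΔ₂ : IsSlimGroup F.geom} {hne₂ : F.geom ≠ ⊥}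
  {C₃ : CuspidalData K} {hP₃ : IsSlimGroup K.arith} {hΔ₃ : IsSlimGroup K.geom} {hne₃ : K.geom ≠ ⊥}
  {c₁ c₁' : E.PiChain C₁ hP₁ hΔ₁ hne₁} {c₂ c₂' : F.PiChain C₂ hP₂ hΔ₂ hne₂}
  {c₃ : K.PiChain C₃ hP₃ hΔ₃ hne₃}

/-- Inverse of a chain isomorphism. [cite: MochizukiAbsTopI2012, Def 4.2 (iv) p.50] -/
theorem symm (h : PiChainIsoOver φ c₁ c₂) : PiChainIsoOver φ.symm c₂ c₁ := by
  obtain ⟨hlen, htypes, hterms⟩ := h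
  refine ⟨hlen.symm, fun j₂ j₁ hj => (htypes j₁ j₂ hj.symm).symm, fun j₂ j₁ hj => ?_⟩
  obtain ⟨I⟩ := hterms j₁ j₂ hj.symm
  exact ⟨I.symm⟩

/-- Composition of chain isomorphisms. [cite: MochizukiAbsTopI2012, Def 4.2 (iv) p.50] -/
theorem trans (h : PiChainIsoOver φ c₁ c₂) (h' : PiChainIsoOver ψ c₂ c₃) :
    PiChainIsoOver (φ ≪≫ ψ) c₁ c₃ := by
  obtain ⟨hlen, htypes, hterms⟩ := h
  obtain ⟨hlen', htypes', hterms'⟩ := h'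
  refine ⟨hlen.trans hlen', fun j₁ j₃ hj => ?_, fun j₁ j₃ hj => ?_⟩
  · exact (htypes j₁ ⟨j₁.val, by omega⟩ rfl).trans (htypes' ⟨j₁.val, by omega⟩ j₃ hj)
  · obtain ⟨I⟩ := hterms j₁ ⟨j₁.val, by omega⟩ rfl
    obtain ⟨J⟩ := hterms' ⟨j₁.val, by omega⟩ j₃ hj
    exact ⟨I.trans J⟩

/-- Transport along an equality of the base isomorphism. [cite: MochizukiAbsTopI2012, Def 4.2 (iv) p.50] -/
theorem of_eq {φ' : E ≅ F} (e : φ = φ') (h : PiChainIsoOver φ c₁ c₂) : PiChainIsoOver φ' c₁ c₂ := by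
  subst e
  exact h

/-- A terminal homomorphism `c₁ → c₁'` transfers along chain isomorphisms over `φ` to a terminal
homomorphism `c₂ → c₂'` (conjugate the representative by the last-term isomorphisms; the Galois
compatibility element `g` becomes `φ(g)`). [cite: MochizukiAbsTopI2012, Thm 4.7 (ii) p.57] -/
theorem hasTerminalHom_transfer (h : PiChainIsoOver φ c₁ c₂) (h' : PiChainIsoOver φ c₁' c₂')
    (ht : c₁.HasTerminalHom c₁') : c₂.HasTerminalHom c₂' := by
  obtain ⟨I⟩ := h.nonempty_last
  obtain ⟨I'⟩ := h'.nonempty_last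
  obtain ⟨t, g, hopen, hcompat⟩ := ht
  -- the transferred representative `I' ∘ t ∘ I⁻¹`
  let t₂ : c₂.last.grp →ₜ* c₂'.last.grp :=
    { toMonoidHom := I'.iso.toMonoidHom.comp (t.toMonoidHom.comp I.iso.symm.toMonoidHom)
      continuous_toFun := I'.iso.continuous.comp (t.continuous.comp I.iso.symm.continuous) }
  refine ⟨t₂, φ.hom.gal g, ?_, fun y => ?_⟩
  · have hr : Set.range t₂ = I'.iso.toHomeomorph '' Set.range t := by
      ext z
      simp only [Set.mem_range, Set.mem_image]
      constructor
      · rintro ⟨y, rfl⟩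
        exact ⟨t (I.iso.symm y), ⟨I.iso.symm y, rfl⟩, rfl⟩
      · rintro ⟨_, ⟨x, rfl⟩, rfl⟩
        exact ⟨I.iso x, by
          change I'.iso (t (I.iso.symm (I.iso x))) = _
          rw [ContinuousMulEquiv.symm_apply_apply]
          rfl⟩
    rw [hr]
    exact I'.iso.toHomeomorph.isOpenMap _ hopen
  · change c₂'.last.proj (I'.iso (t (I.iso.symm y))) = _
    rw [I'.proj_comm, hcompat, MulAut.conj_apply, MulAut.conj_apply, map_mul, map_mul, map_inv,
      ← I.proj_comm (I.iso.symm y), ContinuousMulEquiv.apply_symm_apply]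

/-- A terminal isomorphism transfers along chain isomorphisms over `φ`.
[cite: MochizukiAbsTopI2012, Thm 4.7 (ii) p.57] -/
theorem hasTerminalIso_transfer (h : PiChainIsoOver φ c₁ c₂) (h' : PiChainIsoOver φ c₁' c₂')
    (ht : c₁.HasTerminalIso c₁') : c₂.HasTerminalIso c₂' := by
  obtain ⟨I⟩ := h.nonempty_last
  obtain ⟨I'⟩ := h'.nonempty_last
  obtain ⟨t, g, hcompat⟩ := ht
  refine ⟨I.iso.symm.trans (t.trans I'.iso), φ.hom.gal g, fun y => ?_⟩
  change c₂'.last.proj (I'.iso (t (I.iso.symm y))) = _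
  rw [I'.proj_comm, hcompat, MulAut.conj_apply, MulAut.conj_apply, map_mul, map_mul, map_inv,
    ← I.proj_comm (I.iso.symm y), ContinuousMulEquiv.apply_symm_apply]

/-- Terminal homomorphisms correspond under chain isomorphisms over `φ` (both directions).
[cite: MochizukiAbsTopI2012, Thm 4.7 (iv) p.57] -/
theorem hasTerminalHom_iff (h : PiChainIsoOver φ c₁ c₂) (h' : PiChainIsoOver φ c₁' c₂') :
    c₁.HasTerminalHom c₁' ↔ c₂.HasTerminalHom c₂' :=
  ⟨hasTerminalHom_transfer h h', hasTerminalHom_transfer h.symm h'.symm⟩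

/-- Terminal isomorphisms correspond under chain isomorphisms over `φ`.
[cite: MochizukiAbsTopI2012, Thm 4.7 (ii) p.57] -/
theorem hasTerminalIso_iff (h : PiChainIsoOver φ c₁ c₂) (h' : PiChainIsoOver φ c₁' c₂') :
    c₁.HasTerminalIso c₁' ↔ c₂.HasTerminalIso c₂' :=
  ⟨hasTerminalIso_transfer h h', hasTerminalIso_transfer h.symm h'.symm⟩

/-- Isomorphy classes correspond: `c₁ ≅ c₁'` in `Chain(Π_E)` iff `c₂ ≅ c₂'` in `Chain(Π_F)` for
`φ`-related pairs. [cite: MochizukiAbsTopI2012, Thm 4.7 (ii) p.57] -/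
theorem isoOver_refl_iff (h : PiChainIsoOver φ c₁ c₂) (h' : PiChainIsoOver φ c₁' c₂') :
    PiChainIsoOver (Iso.refl E) c₁ c₁' ↔ PiChainIsoOver (Iso.refl F) c₂ c₂' := by
  constructor
  · intro k
    exact of_eq (by simp) ((h.symm.trans k).trans h')
  · intro k
    exact of_eq (by simp) ((h.trans k).trans h'.symm)

end PiChainIsoOver

/-- **Theorem 4.7 (iv) holds** for the Π-chains of `AbsTopIChains.lean`: PROVED by transferring
terminal homomorphisms along the chain isomorphisms ("the definitions of the various categories
involved are entirely group-theoretic", proof p. 58).  (The cuspidal-data compatibility hypothesis is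
not even needed for this clause.) [cite: MochizukiAbsTopI2012, Thm 4.7 (iv) p.57] -/
theorem thm_4_7_iv_holds : Thm_4_7_iv.{u} :=
  fun _ _ _ _ _ _ _ _ _ _ _ _ _ _ _ _ h h' => PiChainIsoOver.hasTerminalHom_iff h h'

/-- The MORPHISM part of Theorem 4.7 (ii) holds for the Π-chains of `AbsTopIChains.lean`: for
`φ`-related pairs, isomorphy in `Chain(Π)` and terminal isomorphisms correspond — PROVED.  (The
object part — every `Π_E`-chain is `φ`-isomorphic to some `Π_F`-chain — is the transport-of-structure
construction, not carried out here.) [cite: MochizukiAbsTopI2012, Thm 4.7 (ii) p.57] -/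
theorem thm_4_7_ii_morphisms {E F : FundamentalExtension.{u}} (φ : E ≅ F) {C₁ : CuspidalData E}
    {C₂ : CuspidalData F} {hP₁ : IsSlimGroup E.arith} {hΔ₁ : IsSlimGroup E.geom} {hne₁ : E.geom ≠ ⊥}
    {hP₂ : IsSlimGroup F.arith} {hΔ₂ : IsSlimGroup F.geom} {hne₂ : F.geom ≠ ⊥}
    (c₁ c₁' : E.PiChain C₁ hP₁ hΔ₁ hne₁) (c₂ c₂' : F.PiChain C₂ hP₂ hΔ₂ hne₂)
    (h : PiChainIsoOver φ c₁ c₂) (h' : PiChainIsoOver φ c₁' c₂') :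
    (PiChainIsoOver (Iso.refl E) c₁ c₁' ↔ PiChainIsoOver (Iso.refl F) c₂ c₂') ∧
      (c₁.HasTerminalIso c₁' ↔ c₂.HasTerminalIso c₂') :=
  ⟨h.isoOver_refl_iff h', h.hasTerminalIso_iff h'⟩

end Literature.AnabelianGeometry.AbsoluteAnabelian.AbsTopI
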